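import Summits.Ventures.HodgeRepro2.T5IsotropicTransitivity

/-!
# A split hermitian plane IS the hyperbolic plane, and its unitary group IS `U(ℍ)`

Kernel support (seat p3, cell pub-hodge-repro2) behind §F.1 of `route/T5-route-3.md` (the
normalisation of `c_v(χ_v)`), whose sentence «A character of `U(W)` (`W` split, `n ≥ 2`; …) is
`ν′∘det`» was kernel-checked in files 74 / 75 / 79 / 81 of this seat for the MODEL
`U(ℍ) = hypUnitary E` of file 23 — leaving as prose «that `U(W₁₂,v)` at a split `W₁₂,v` IS
file 16's `U(ℍ)`». This file closes that reading at the level of Gram matrices: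

* `gramForm H v w = star v ⬝ᵥ (H *ᵥ w)` is the sesquilinear form of a `2 × 2` Gram matrix `H`
  (file 27's `hypForm` is `gramForm hyp`, `hypForm_eq_gramForm`); for hermitian `H` it is
  conjugate-symmetric (`gramForm_swap`);
* `unitaryOf H = {g ∈ GL₂(E) : gᴴ H g = H}` is the unitary group of `H`; file 23's
  `hypUnitary E` is `unitaryOf hyp` (`hypUnitary_eq_unitaryOf`); scaling the form does not
  change the group (`unitaryOf_smul` — so a SKEW-hermitian `δ·H`, `δ̄ = −δ`, has the same
  unitary group as the hermitian `H`: the δ-twist of file 78 / §C);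
* an isometry `Pᴴ H P = H′` transports the unitary groups: `U(H) = P·U(H′)·P⁻¹`
  (`conj_mem_unitaryOf_iff`, `unitaryOf_eq_map_conj`, `unitaryOfEquiv`);
* THE HYPERBOLIC BASIS: a non-degenerate hermitian plane with a non-zero isotropic vector has a
  hyperbolic basis — `∃ P ∈ GL₂(E), Pᴴ H P = ℍ` (`exists_hyperbolic_basis`: scale a vector
  pairing to `1` with `v`, then make it isotropic by adding `c·v` with `c + c̄ = −⟨w,w⟩`, which
  is solvable because the trace `a ↦ a + ā` is not identically zero when the involution is
  non-trivial, `exists_trace_ne_zero`); hence `U(H) = P·U(ℍ)·P⁻¹` and `U(H) ≅ U(ℍ)`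
  (`exists_unitaryOf_eq_map_conj`, `nonempty_mulEquiv_hypUnitary`).

So for a split `W₁₂,v` (a `2`-dimensional skew-hermitian `E_v`-space with an isotropic vector)
the group `U(W₁₂,v)` is `GL₂`-conjugate to the model `U(ℍ)` in which files 23–27, 74–75, 79
and 81 were proved; the identification of the datum's `W₁₂,v` with a Gram matrix over `E_v`
stays prose (p4's completion files supply `E_v`). Header declaration (README §8(d)): uses an
L-value-free non-vanishing device: no.
-/

namespace Summit.Ventures.HodgeRepro2.T5SplitHermitianPlane

open T5UnipotentCommutator T5IsotropicTransitivity Matrix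

variable {E : Type*} [Field E] [StarRing E]

section GramForm

/-- The sesquilinear form of a `2 × 2` Gram matrix `H`: `⟨v, w⟩_H = star v ⬝ᵥ (H *ᵥ w)`,
conjugate-linear in `v` and linear in `w` (file 27's convention). -/
def gramForm (H : Matrix (Fin 2) (Fin 2) E) (v w : Fin 2 → E) : E :=
  star ∘ v ⬝ᵥ H.mulVec w

/-- The form of the hyperbolic plane is file 27's `hypForm`. -/
theorem hypForm_eq_gramForm (v w : Fin 2 → E) : hypForm v w = gramForm hyp v w :=
  hypForm_eq v w

/-- The Gram form expanded in coordinates. -/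
theorem gramForm_eq_sum (H : Matrix (Fin 2) (Fin 2) E) (v w : Fin 2 → E) :
    gramForm H v w = star (v 0) * (H 0 0 * w 0 + H 0 1 * w 1) +
      star (v 1) * (H 1 0 * w 0 + H 1 1 * w 1) := by
  simp only [gramForm, dotProduct, mulVec, Fin.sum_univ_two, Function.comp_apply]

/-- Additivity in the second slot. -/
theorem gramForm_add_right (H : Matrix (Fin 2) (Fin 2) E) (v w₁ w₂ : Fin 2 → E) :
    gramForm H v (w₁ + w₂) = gramForm H v w₁ + gramForm H v w₂ := by
  simp only [gramForm_eq_sum, Pi.add_apply]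
  ring

/-- Linearity in the second slot. -/
theorem gramForm_smul_right (H : Matrix (Fin 2) (Fin 2) E) (v : Fin 2 → E) (c : E)
    (w : Fin 2 → E) : gramForm H v (c • w) = c * gramForm H v w := by
  simp only [gramForm_eq_sum, Pi.smul_apply, smul_eq_mul]
  ring

/-- Additivity in the first slot. -/
theorem gramForm_add_left (H : Matrix (Fin 2) (Fin 2) E) (v₁ v₂ w : Fin 2 → E) :
    gramForm H (v₁ + v₂) w = gramForm H v₁ w + gramForm H v₂ w := by
  simp only [gramForm_eq_sum, Pi.add_apply, star_add]
  ring

/-- Conjugate-linearity in the first slot. -/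
theorem gramForm_smul_left (H : Matrix (Fin 2) (Fin 2) E) (c : E) (v w : Fin 2 → E) :
    gramForm H (c • v) w = star c * gramForm H v w := by
  simp only [gramForm_eq_sum, Pi.smul_apply, smul_eq_mul, star_mul']
  ring

/-- For a hermitian Gram matrix (`Hᴴ = H`) the form is conjugate-symmetric:
`⟨w, v⟩ = star ⟨v, w⟩`. -/
theorem gramForm_swap (H : Matrix (Fin 2) (Fin 2) E) (hH : Hᴴ = H) (v w : Fin 2 → E) :
    gramForm H w v = star (gramForm H v w) := by
  have h' : ∀ i j, star (H i j) = H j i := fun i j => by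
    have := congrFun (congrFun hH j) i
    rwa [conjTranspose_apply] at this
  simp only [gramForm_eq_sum, star_add, star_mul', star_star, h']
  ring

/-- For a hermitian Gram matrix, `⟨v, v⟩` is `star`-fixed. -/
theorem star_gramForm_self (H : Matrix (Fin 2) (Fin 2) E) (hH : Hᴴ = H) (v : Fin 2 → E) :
    star (gramForm H v v) = gramForm H v v :=
  (gramForm_swap H hH v v).symm

/-- The `(j, k)`-entry of `Pᴴ H P` is the form evaluated on the `j`-th and `k`-th columns of
`P`. -/
theorem conjTranspose_mul_mul_apply (P H : Matrix (Fin 2) (Fin 2) E) (j k : Fin 2) :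
    (Pᴴ * H * P) j k = gramForm H (fun i => P i j) (fun i => P i k) := by
  simp only [Matrix.mul_apply, conjTranspose_apply, gramForm_eq_sum, Fin.sum_univ_two]
  ring

/-- The first basis vector of the hyperbolic plane is isotropic. -/
theorem gramForm_hyp_self_zero : gramForm (hyp (E := E)) ![1, 0] ![1, 0] = 0 := by
  simp [gramForm_eq_sum, hyp, T5LocalHermitian.hyperbolicPlane]

end GramForm

section UnitaryGroup

/-- The unitary group of a Gram matrix `H`: the `g ∈ GL₂(E)` with `gᴴ H g = H`. -/
def unitaryOf (H : Matrix (Fin 2) (Fin 2) E) : Subgroup (GL (Fin 2) E) where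
  carrier := {g | (g : Matrix (Fin 2) (Fin 2) E)ᴴ * H * g = H}
  mul_mem' := by
    intro g h hg hh
    simp only [Set.mem_setOf_eq] at hg hh ⊢
    rw [Units.val_mul, conjTranspose_mul]
    calc (h : Matrix (Fin 2) (Fin 2) E)ᴴ * (g : Matrix (Fin 2) (Fin 2) E)ᴴ * H * (↑g * ↑h)
        = (h : Matrix (Fin 2) (Fin 2) E)ᴴ * ((g : Matrix (Fin 2) (Fin 2) E)ᴴ * H * ↑g) * ↑h := by
          simp only [Matrix.mul_assoc]
      _ = H := by rw [hg, hh]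
  one_mem' := by simp
  inv_mem' := by
    intro g hg
    simp only [Set.mem_setOf_eq] at hg ⊢
    have h1 : ((g⁻¹ : GL (Fin 2) E) : Matrix (Fin 2) (Fin 2) E)ᴴ *
        (g : Matrix (Fin 2) (Fin 2) E)ᴴ = 1 := by
      rw [← conjTranspose_mul]
      simp
    have h2 : (g : Matrix (Fin 2) (Fin 2) E) * ((g⁻¹ : GL (Fin 2) E) : Matrix (Fin 2) (Fin 2) E) =
        1 := by simp
    calc ((g⁻¹ : GL (Fin 2) E) : Matrix (Fin 2) (Fin 2) E)ᴴ * H * ↑g⁻¹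
        = ((g⁻¹ : GL (Fin 2) E) : Matrix (Fin 2) (Fin 2) E)ᴴ *
            ((g : Matrix (Fin 2) (Fin 2) E)ᴴ * H * ↑g) * ↑g⁻¹ := by rw [hg]
      _ = (((g⁻¹ : GL (Fin 2) E) : Matrix (Fin 2) (Fin 2) E)ᴴ * (g : Matrix (Fin 2) (Fin 2) E)ᴴ) *
            H * ((g : Matrix (Fin 2) (Fin 2) E) * ↑g⁻¹) := by simp only [Matrix.mul_assoc]
      _ = H := by rw [h1, h2, Matrix.one_mul, Matrix.mul_one]

/-- Membership in the unitary group, by definition. -/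
theorem mem_unitaryOf_iff (H : Matrix (Fin 2) (Fin 2) E) (g : GL (Fin 2) E) :
    g ∈ unitaryOf H ↔ (g : Matrix (Fin 2) (Fin 2) E)ᴴ * H * g = H :=
  Iff.rfl

/-- File 23's `U(ℍ)` is the unitary group of the Gram matrix `ℍ`. -/
theorem hypUnitary_eq_unitaryOf : hypUnitary E = unitaryOf hyp := by
  ext g
  exact mem_hypUnitary_iff g

/-- Scaling the Gram matrix by a non-zero scalar does not change the unitary group — in
particular a skew-hermitian `δ • H` (`δ̄ = −δ`, `H` hermitian) has the unitary group of `H`. -/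
theorem unitaryOf_smul (H : Matrix (Fin 2) (Fin 2) E) (c : E) (hc : c ≠ 0) :
    unitaryOf (c • H) = unitaryOf H := by
  ext g
  simp only [mem_unitaryOf_iff, Matrix.mul_smul, Matrix.smul_mul]
  exact smul_right_injective (Matrix (Fin 2) (Fin 2) E) hc |>.eq_iff

/-- The sandwich identity `(P⁻¹)ᴴ (Pᴴ X P) P⁻¹ = X`. -/
theorem sandwich (P : GL (Fin 2) E) (X : Matrix (Fin 2) (Fin 2) E) :
    ((P⁻¹ : GL (Fin 2) E) : Matrix (Fin 2) (Fin 2) E)ᴴ *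
      ((P : Matrix (Fin 2) (Fin 2) E)ᴴ * X * P) * (P⁻¹ : GL (Fin 2) E) = X := by
  have h1 : ((P⁻¹ : GL (Fin 2) E) : Matrix (Fin 2) (Fin 2) E)ᴴ *
      (P : Matrix (Fin 2) (Fin 2) E)ᴴ = 1 := by
    rw [← conjTranspose_mul]
    simp
  have h2 : (P : Matrix (Fin 2) (Fin 2) E) * ((P⁻¹ : GL (Fin 2) E) : Matrix (Fin 2) (Fin 2) E) =
      1 := by simp
  calc ((P⁻¹ : GL (Fin 2) E) : Matrix (Fin 2) (Fin 2) E)ᴴ *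
        ((P : Matrix (Fin 2) (Fin 2) E)ᴴ * X * P) * (P⁻¹ : GL (Fin 2) E)
      = (((P⁻¹ : GL (Fin 2) E) : Matrix (Fin 2) (Fin 2) E)ᴴ * (P : Matrix (Fin 2) (Fin 2) E)ᴴ) *
          X * ((P : Matrix (Fin 2) (Fin 2) E) * (P⁻¹ : GL (Fin 2) E)) := by
        simp only [Matrix.mul_assoc]
    _ = X := by rw [h1, h2, Matrix.one_mul, Matrix.mul_one]

/-- The sandwich identity `Pᴴ ((P⁻¹)ᴴ X P⁻¹) P = X`. -/
theorem sandwich_inv (P : GL (Fin 2) E) (X : Matrix (Fin 2) (Fin 2) E) :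
    (P : Matrix (Fin 2) (Fin 2) E)ᴴ *
      (((P⁻¹ : GL (Fin 2) E) : Matrix (Fin 2) (Fin 2) E)ᴴ * X * (P⁻¹ : GL (Fin 2) E)) * P = X := by
  have h1 : (P : Matrix (Fin 2) (Fin 2) E)ᴴ *
      ((P⁻¹ : GL (Fin 2) E) : Matrix (Fin 2) (Fin 2) E)ᴴ = 1 := by
    rw [← conjTranspose_mul]
    simp
  have h2 : ((P⁻¹ : GL (Fin 2) E) : Matrix (Fin 2) (Fin 2) E) * (P : Matrix (Fin 2) (Fin 2) E) =
      1 := by simp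
  calc (P : Matrix (Fin 2) (Fin 2) E)ᴴ *
        (((P⁻¹ : GL (Fin 2) E) : Matrix (Fin 2) (Fin 2) E)ᴴ * X * (P⁻¹ : GL (Fin 2) E)) * P
      = ((P : Matrix (Fin 2) (Fin 2) E)ᴴ * ((P⁻¹ : GL (Fin 2) E) : Matrix (Fin 2) (Fin 2) E)ᴴ) *
          X * (((P⁻¹ : GL (Fin 2) E) : Matrix (Fin 2) (Fin 2) E) * P) := by
        simp only [Matrix.mul_assoc]
    _ = X := by rw [h1, h2, Matrix.one_mul, Matrix.mul_one]

/-- TRANSPORT: if `Pᴴ H P = H′` then `g ∈ U(H′)` iff `P g P⁻¹ ∈ U(H)`. -/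
theorem conj_mem_unitaryOf_iff {H H' : Matrix (Fin 2) (Fin 2) E} (P : GL (Fin 2) E)
    (hP : (P : Matrix (Fin 2) (Fin 2) E)ᴴ * H * P = H') (g : GL (Fin 2) E) :
    P * g * P⁻¹ ∈ unitaryOf H ↔ g ∈ unitaryOf H' := by
  rw [mem_unitaryOf_iff, mem_unitaryOf_iff]
  have key : ((P * g * P⁻¹ : GL (Fin 2) E) : Matrix (Fin 2) (Fin 2) E)ᴴ * H *
      ((P * g * P⁻¹ : GL (Fin 2) E) : Matrix (Fin 2) (Fin 2) E) =
      ((P⁻¹ : GL (Fin 2) E) : Matrix (Fin 2) (Fin 2) E)ᴴ *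
        ((g : Matrix (Fin 2) (Fin 2) E)ᴴ * H' * g) * (P⁻¹ : GL (Fin 2) E) := by
    rw [← hP]
    simp only [Units.val_mul, conjTranspose_mul, Matrix.mul_assoc]
  rw [key]
  constructor
  · intro h
    have := congrArg (fun X => (P : Matrix (Fin 2) (Fin 2) E)ᴴ * X * P) h
    simp only [sandwich_inv] at this
    rw [this, hP]
  · intro h
    rw [h, ← hP]
    exact sandwich P H

/-- TRANSPORT as subgroups: `U(H) = P · U(H′) · P⁻¹` when `Pᴴ H P = H′`. -/
theorem unitaryOf_eq_map_conj {H H' : Matrix (Fin 2) (Fin 2) E} (P : GL (Fin 2) E)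
    (hP : (P : Matrix (Fin 2) (Fin 2) E)ᴴ * H * P = H') :
    unitaryOf H = (unitaryOf H').map (MulAut.conj P).toMonoidHom := by
  ext x
  rw [Subgroup.mem_map_equiv, MulAut.conj_symm_apply, ← conj_mem_unitaryOf_iff P hP]
  have hx : P * (P⁻¹ * x * P) * P⁻¹ = x := by group
  rw [hx]

/-- TRANSPORT as an isomorphism of groups: `U(H′) ≅ U(H)` along `Pᴴ H P = H′`. -/
noncomputable def unitaryOfEquiv {H H' : Matrix (Fin 2) (Fin 2) E} (P : GL (Fin 2) E)
    (hP : (P : Matrix (Fin 2) (Fin 2) E)ᴴ * H * P = H') : unitaryOf H' ≃* unitaryOf H :=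
  ((MulAut.conj P).subgroupMap (unitaryOf H')).trans
    (MulEquiv.subgroupCongr (unitaryOf_eq_map_conj P hP).symm)

/-- The transport isomorphism is conjugation by `P`. -/
theorem coe_unitaryOfEquiv {H H' : Matrix (Fin 2) (Fin 2) E} (P : GL (Fin 2) E)
    (hP : (P : Matrix (Fin 2) (Fin 2) E)ᴴ * H * P = H') (g : unitaryOf H') :
    ((unitaryOfEquiv P hP g : unitaryOf H) : GL (Fin 2) E) = P * g * P⁻¹ :=
  rfl

end UnitaryGroup

section HyperbolicBasis

/-- If the involution is non-trivial, the trace `a ↦ a + star a` is not identically zero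
(`a₀ = 1` unless `2 = 0`; in characteristic `2` any `a` with `star a ≠ a` works). -/
theorem exists_trace_ne_zero (hne : ∃ a : E, star a ≠ a) : ∃ a₀ : E, a₀ + star a₀ ≠ 0 := by
  by_cases h2 : (2 : E) = 0
  · obtain ⟨a, ha⟩ := hne
    refine ⟨a, fun h => ha ?_⟩
    have hsa : star a = -a := eq_neg_of_add_eq_zero_right h
    have h2a : a + a = 0 := by
      have := congrArg (· * a) h2
      simpa [two_mul] using this
    rw [hsa]
    exact neg_eq_of_add_eq_zero_left h2a
  · exact ⟨1, by simpa [one_add_one_eq_two] using h2⟩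

/-- Every `star`-fixed `b` is a trace: `b = c + star c` for some `c` (the involution being
non-trivial): `c = b·a₀/(a₀ + star a₀)`. -/
theorem exists_add_star_eq (hne : ∃ a : E, star a ≠ a) (b : E) (hb : star b = b) :
    ∃ c : E, c + star c = b := by
  obtain ⟨a₀, ha₀⟩ := exists_trace_ne_zero hne
  have hs : star (a₀ + star a₀) = a₀ + star a₀ := by
    rw [star_add, star_star, add_comm]
  refine ⟨b * a₀ / (a₀ + star a₀), ?_⟩
  rw [star_div₀, star_mul', hb, hs]
  field_simp

/-- THE HYPERBOLIC BASIS: a `2 × 2` hermitian Gram matrix `H` with `det H ≠ 0` and a non-zero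
isotropic vector `v` admits `P ∈ GL₂(E)` with `Pᴴ H P = ℍ` — the first column of `P` is `v`,
the second a vector `w` with `⟨v, w⟩ = 1` and `⟨w, w⟩ = 0`. -/
theorem exists_hyperbolic_basis (hne : ∃ a : E, star a ≠ a) (H : Matrix (Fin 2) (Fin 2) E)
    (hH : Hᴴ = H) (hdet : H.det ≠ 0) (v : Fin 2 → E) (hv : v ≠ 0) (hiso : gramForm H v v = 0) :
    ∃ P : GL (Fin 2) E,
      (P : Matrix (Fin 2) (Fin 2) E)ᴴ * H * (P : Matrix (Fin 2) (Fin 2) E) = hyp := by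
  -- a vector pairing non-trivially with `v`
  have hHv : H.mulVec v ≠ 0 := by
    intro h0
    exact hdet (Matrix.exists_mulVec_eq_zero_iff.1 ⟨v, hv, h0⟩)
  obtain ⟨i, hi⟩ : ∃ i, H.mulVec v i ≠ 0 := by
    obtain ⟨i, hi⟩ := Function.ne_iff.1 hHv
    exact ⟨i, hi⟩
  have h1 : gramForm H (Pi.single i 1) v = H.mulVec v i := by
    fin_cases i <;> simp [gramForm, dotProduct, Fin.sum_univ_two]
  have h2 : gramForm H v (Pi.single i 1) ≠ 0 := by
    rw [gramForm_swap H hH, h1]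
    exact star_ne_zero.2 hi
  -- `w₁` pairs to `1` with `v`
  obtain ⟨w₁, hw₁, hw₁v⟩ : ∃ w₁ : Fin 2 → E, gramForm H v w₁ = 1 ∧ gramForm H w₁ v = 1 := by
    refine ⟨(gramForm H v (Pi.single i 1))⁻¹ • Pi.single i 1, ?_, ?_⟩
    · rw [gramForm_smul_right]
      exact inv_mul_cancel₀ h2
    · rw [gramForm_swap H hH, gramForm_smul_right, inv_mul_cancel₀ h2, star_one]
  -- `w₂ = w₁ + c • v` is isotropic, where `c + star c = -⟨w₁, w₁⟩`
  obtain ⟨c, hc⟩ := exists_add_star_eq hne (-(gramForm H w₁ w₁))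
    (by rw [star_neg, star_gramForm_self H hH])
  obtain ⟨w₂, hvw₂, hw₂v, hw₂⟩ : ∃ w₂ : Fin 2 → E,
      gramForm H v w₂ = 1 ∧ gramForm H w₂ v = 1 ∧ gramForm H w₂ w₂ = 0 := by
    have hvw₂ : gramForm H v (w₁ + c • v) = 1 := by
      rw [gramForm_add_right, gramForm_smul_right, hw₁, hiso, mul_zero, add_zero]
    refine ⟨w₁ + c • v, hvw₂, ?_, ?_⟩
    · rw [gramForm_swap H hH, hvw₂, star_one]
    · rw [gramForm_add_left, gramForm_smul_left, gramForm_add_right, gramForm_smul_right,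
        hw₁v, hvw₂]
      linear_combination hc
  -- the matrix with columns `v`, `w₂`
  let P : Matrix (Fin 2) (Fin 2) E := Matrix.of fun i j => ![v, w₂] j i
  have hcol0 : (fun i => P i 0) = v := rfl
  have hcol1 : (fun i => P i 1) = w₂ := rfl
  have hPH : Pᴴ * H * P = hyp := by
    ext j k
    rw [conjTranspose_mul_mul_apply]
    fin_cases j <;> fin_cases k
    · simp only [Fin.zero_eta, Fin.isValue, hcol0, hiso, hyp, T5LocalHermitian.hyperbolicPlane]
      rfl
    · simp only [Fin.zero_eta, Fin.mk_one, Fin.isValue, hcol0, hcol1, hvw₂, hyp,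
        T5LocalHermitian.hyperbolicPlane]
      rfl
    · simp only [Fin.zero_eta, Fin.mk_one, Fin.isValue, hcol0, hcol1, hw₂v, hyp,
        T5LocalHermitian.hyperbolicPlane]
      rfl
    · simp only [Fin.mk_one, Fin.isValue, hcol1, hw₂, hyp, T5LocalHermitian.hyperbolicPlane]
      rfl
  have hdetP : P.det ≠ 0 := by
    intro h0
    have := congrArg Matrix.det hPH
    rw [det_mul, det_mul, h0, mul_zero, T5LocalHermitian.det_hyperbolicPlane] at this
    exact (neg_ne_zero.2 one_ne_zero) this.symm
  exact ⟨GeneralLinearGroup.mkOfDetNeZero P hdetP, hPH⟩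

/-- «`U(W)` IS `U(ℍ)`»: the unitary group of a non-degenerate hermitian plane with a non-zero
isotropic vector is a `GL₂(E)`-conjugate of file 23's `hypUnitary E`. -/
theorem exists_unitaryOf_eq_map_conj (hne : ∃ a : E, star a ≠ a) (H : Matrix (Fin 2) (Fin 2) E)
    (hH : Hᴴ = H) (hdet : H.det ≠ 0) (v : Fin 2 → E) (hv : v ≠ 0) (hiso : gramForm H v v = 0) :
    ∃ P : GL (Fin 2) E, unitaryOf H = (hypUnitary E).map (MulAut.conj P).toMonoidHom := by
  obtain ⟨P, hP⟩ := exists_hyperbolic_basis hne H hH hdet v hv hiso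
  exact ⟨P, by rw [hypUnitary_eq_unitaryOf]; exact unitaryOf_eq_map_conj P hP⟩

/-- «`U(W) ≅ U(ℍ)`» as abstract groups, for a non-degenerate hermitian plane with a non-zero
isotropic vector. -/
theorem nonempty_mulEquiv_hypUnitary (hne : ∃ a : E, star a ≠ a) (H : Matrix (Fin 2) (Fin 2) E)
    (hH : Hᴴ = H) (hdet : H.det ≠ 0) (v : Fin 2 → E) (hv : v ≠ 0) (hiso : gramForm H v v = 0) :
    Nonempty (hypUnitary E ≃* unitaryOf H) := by
  obtain ⟨P, hP⟩ := exists_hyperbolic_basis hne H hH hdet v hv hiso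
  exact ⟨(MulEquiv.subgroupCongr hypUnitary_eq_unitaryOf).trans (unitaryOfEquiv P hP)⟩

/-- The converse direction of «split ⟺ isotropic»: a plane isometric to `ℍ` (`Pᴴ H P = ℍ`)
has the non-zero isotropic vector `P e₀`. -/
theorem exists_isotropic_of_hyperbolic (H : Matrix (Fin 2) (Fin 2) E) (P : GL (Fin 2) E)
    (hP : (P : Matrix (Fin 2) (Fin 2) E)ᴴ * H * (P : Matrix (Fin 2) (Fin 2) E) = hyp) :
    ∃ v : Fin 2 → E, v ≠ 0 ∧ gramForm H v v = 0 := by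
  refine ⟨fun i => (P : Matrix (Fin 2) (Fin 2) E) i 0, ?_, ?_⟩
  · intro h0
    have hP0 : ((P⁻¹ : GL (Fin 2) E) : Matrix (Fin 2) (Fin 2) E) * (P : Matrix (Fin 2) (Fin 2) E)
        = 1 := by simp
    have := congrFun (congrFun hP0 0) 0
    rw [Matrix.mul_apply, Fin.sum_univ_two] at this
    have e0 : (P : Matrix (Fin 2) (Fin 2) E) 0 0 = 0 := congrFun h0 0
    have e1 : (P : Matrix (Fin 2) (Fin 2) E) 1 0 = 0 := congrFun h0 1
    rw [e0, e1] at this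
    simp at this
  · rw [← conjTranspose_mul_mul_apply, hP]
    simp [hyp, T5LocalHermitian.hyperbolicPlane]

end HyperbolicBasis

end Summit.Ventures.HodgeRepro2.T5SplitHermitianPlane
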